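import Summits.QuantumAdvantage.AdviceFreeQNC0.EliminationHardnessF
import Literature.Computability.MetaComplexity.TConstantProbDegree
import HarnessLib

/-!
# Cell qa-qnc0 (odd primes, route `OddPrimeWalk`, rung R6 input): the BRIDGE from a probabilistic family
# of level-set polynomials (`Smolensky.UFam`) to robust elimination (`elimLevelSqrtF_robust`)

Planner qa-qnc0-p2 g15 (STATUS 2026-08-27T21:31Z, R6 division of labour): the √n-shots rung realises the three
level sets of the named residue `e : {0,1}ⁿ → ℕ` only by a PROBABILISTIC family of low-degree polynomials
(qn-lit's `Smolensky.ufam_promiseParity_comp` / `UFam.boolPost`, STV21 Thm 18).  This file turns such a family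
into the hypothesis shape of `elimLevelSqrtF_robust` and composes the two:

* the level sets are presented by ANY Boolean family `f : Fin 3 → {0,1}ⁿ → Bool` with
  `f r u = true ↔ e u ≡ r (mod 3)` (so the user's own `fun j u => φ j (…)` from `UFam.boolPost` fits without
  a `funext` rewrite);
* **`exists_levelSets_off_smallSet`** — from `UFam (ZMod p) f ε d` (joint error `ε` at every input over the
  seed space): ONE seed realises all three indicators off an exceptional set `X` with `|X| ≤ ε·2ⁿ`
  (`UFam.exists_realisation` on the whole cube), i.e.
  `∃ X, |X| ≤ ε·2ⁿ ∧ ∀ r, ∃ P ∈ lowDeg (ZMod p) n d, ∀ u ∉ X, P u = [e u ≡ r (3)]`;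
* **`elimLevelSqrtF_ufam`** — the one-stop form: for a prime `p ≠ 3` there are `η₀, ε₀, c₀ > 0`, `n₀` such that
  for `n ≥ n₀`, `d ≤ c₀√n`, `ε ≤ ε₀`, every `e` whose level sets carry such a `UFam (ZMod p) f ε d` names the
  true residue, `e u ≡ |u| (mod 3)`, on `≥ η₀·2ⁿ` inputs.

WHAT THIS IS NOT: no statement about the game (`WalkHardF p` OPEN); the R6 assembly is seat qn-prover-3's;
separation NOT moved.
-/

noncomputable section

namespace Summit.QuantumAdvantage.AdviceFreeQNC0

open Classical
open Finset
open Literature.Computability.MetaComplexity Literature.Computability.MetaComplexity.Smolensky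

variable {n : ℕ}

/-- **Bridge**: a uniform probabilistic family (joint error `ε`) for the three level-set indicators of `e`
(presented by any Boolean family `f` with `f r u ↔ e u ≡ r (mod 3)`) yields ONE tuple of degree-`≤ d`
polynomials agreeing with all three indicators off a set of `≤ ε·2ⁿ` inputs. -/
theorem exists_levelSets_off_smallSet {p : ℕ} [Fact p.Prime] {e : (Fin n → Bool) → ℕ}
    {f : Fin 3 → (Fin n → Bool) → Bool} {ε : ℝ} {d : ℕ}
    (hf : ∀ r u, f r u = true ↔ e u % 3 = r.val) (h : UFam (ZMod p) f ε d) :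
    ∃ X : Finset (Fin n → Bool), (X.card : ℝ) ≤ ε * (2 : ℝ) ^ n ∧
      ∀ r : ℕ, ∃ P : CubeFn (ZMod p) n, P ∈ lowDeg (ZMod p) n d ∧
        ∀ u, u ∉ X → P u = if e u % 3 = r % 3 then (1 : ZMod p) else 0 := by
  obtain ⟨P, hPdeg, hPerr⟩ := h.exists_realisation (univ : Finset (Fin n → Bool))
  have e2 : ((univ : Finset (Fin n → Bool)).card : ℝ) = (2 : ℝ) ^ n := by
    rw [card_univ, Fintype.card_fun, Fintype.card_bool, Fintype.card_fin]; push_cast; ring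
  rw [e2] at hPerr
  refine ⟨_, hPerr, ?_⟩
  · intro r
    have hr : r % 3 < 3 := Nat.mod_lt _ (by norm_num)
    refine ⟨P ⟨r % 3, hr⟩, hPdeg _, fun u hu => ?_⟩
    -- off `X`, `P ⟨r % 3⟩ u` is the Boolean value of the level-set function
    have hok : P ⟨r % 3, hr⟩ u = boolVal (ZMod p) (f ⟨r % 3, hr⟩ u) := by
      by_contra hne
      apply hu
      simp only [Finset.mem_filter, Finset.mem_univ, true_and]
      exact ⟨⟨r % 3, hr⟩, hne⟩
    rw [hok]
    unfold boolVal
    by_cases hc : e u % 3 = r % 3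
    · rw [if_pos hc, if_pos ((hf _ u).2 hc)]
    · have hfu : ¬ f ⟨r % 3, hr⟩ u = true := fun h' => hc ((hf _ u).1 h')
      rw [if_neg hc, if_neg hfu]

/-- **`elimLevelSqrtF_ufam`** — robust level-set elimination for PROBABILISTIC level sets: for a prime
`p ≠ 3` there are `η₀, ε₀, c₀ > 0`, `n₀` such that for `n ≥ n₀`, `d ≤ c₀√n`, `0 ≤ ε ≤ ε₀` and every
`e : {0,1}ⁿ → ℕ` whose three level-set indicators (any Boolean presentation `f`, `f r u ↔ e u ≡ r (mod 3)`) admit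
a `UFam (ZMod p)` of degree `d` and error `ε`, the named residue is the true one on `≥ η₀·2ⁿ` inputs.
(= `exists_levelSets_off_smallSet` ∘ `elimLevelSqrtF_robust`.) -/
theorem elimLevelSqrtF_ufam (p : ℕ) [Fact p.Prime] (hp3 : p ≠ 3) :
    ∃ η₀ : ℝ, 0 < η₀ ∧ ∃ ε₀ : ℝ, 0 < ε₀ ∧ ∃ c₀ : ℝ, 0 < c₀ ∧ ∃ n₀ : ℕ, ∀ n ≥ n₀, ∀ d : ℕ,
      (d : ℝ) ≤ c₀ * Real.sqrt n → ∀ ε : ℝ, ε ≤ ε₀ → ∀ e : (Fin n → Bool) → ℕ,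
        ∀ f : Fin 3 → (Fin n → Bool) → Bool, (∀ r u, f r u = true ↔ e u % 3 = r.val) →
        UFam (ZMod p) f ε d →
        η₀ * (2 : ℝ) ^ n ≤ ((Finset.univ.filter fun u : Fin n → Bool =>
          e u % 3 = Hegedus.wt u % 3).card : ℝ) := by
  obtain ⟨η₀, hη₀, ε₀, hε₀, c₀, hc₀, n₀, H⟩ := elimLevelSqrtF_robust p hp3
  refine ⟨η₀, hη₀, ε₀, hε₀, c₀, hc₀, n₀, fun n hn d hd ε hε e f hf hU => ?_⟩
  obtain ⟨X, hX, hP⟩ := exists_levelSets_off_smallSet hf hU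
  have h2n : (0 : ℝ) ≤ (2 : ℝ) ^ n := by positivity
  exact H n hn d hd e X (hX.trans (mul_le_mul_of_nonneg_right hε h2n)) hP

end Summit.QuantumAdvantage.AdviceFreeQNC0

end
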